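import Summits.BirchSwinnertonDyer.Rank1Residual.ManinAdditive.ShimuraLedger
import Literature.NumberTheory.EllipticCurves.NeronIsogenyScalingHoldsProofs
import HarnessLib

/-!
# E-an-68 `GammaOneIndexFourForcesEvenManin` IS A THEOREM: a homothetic Shimura cover pins the ratio of the
# optimal Manin constants (`Λ₁(f₁) = n·Λ₀(f₀) ⟹ c₀ = ± n·c₁`)

Summit `BirchSwinnertonDyer`, route `ManinLocalTwoThree` (cell bsd-f2-manin), deciding crux C2 `ManinOddAtFour`
(stmt-BirchSwinnertonDyer-22967); the an planner's `Γ₀(N)/Γ₁(N)` LEDGER on the blind residual (MEMO-an §58, leaf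
`Summits/…/ManinAdditive/ShimuraLedger.lean`, refuter-1 §R55: «E-an-68 TRUE on paper from in-tree ingredients alone;
`_holds` target»).  Proved here, with no isogeny hypothesis and for every index:

* `maninConstant₀_eq_mul_or_eq_neg_mul_of_periodLatticeGamma1_eq_mul` — for an OPTIMAL `X₁(N)`-datum `D₁` of a
  globally minimal `W₁` (`Λ_{E₁} = c₁ Λ₁(f₁)`) and an OPTIMAL `X₀(N)`-datum `D₀` of a globally minimal `W₀`
  (`Λ_{E₀} = c₀ Λ₀(f₀)`) whose lattices are HOMOTHETIC by an integer, `Λ₁(f₁) = n · Λ₀(f₀)`: `c₀ = ± n c₁`.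
  Mechanism: `(n c₁/c₀) Λ_{E₀} ⊆ Λ_{E₁}` and `(c₀/(n c₁)) Λ_{E₁} ⊆ Λ_{E₀}`, so BOTH rational scalings are integers
  by the integrality of the Néron scaling of a rational isogeny between globally minimal models
  (`integral_neronScaling_of_isGloballyMinimal_holds`, Silverman *ATAEC* IV.5.1/6.1/9.1 — a tree theorem), and two
  integers with product `1` are `±1`.
* `gammaOneIndexFourForcesEvenManin_holds : GammaOneIndexFourForcesEvenManin` (E-an-68 BY NAME, `n = 2`:
  index `4`, `Λ₁ = 2Λ₀`, forces `c₀ = ±2c₁`, in particular `2 ∣ c₀`), and the kernel-checked contrapositive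
  `index_ne_four_of_not_two_dvd_maninConstant` (C2 for `D₀` forbids `Λ₁(f₁) = 2Λ₀(f₀)`), i.e. the leaf's edge
  `index_ne_four_of_maninOdd` with its hypothesis discharged.
* `natAbs_maninConstant₀_eq_of_periodLatticeGamma1_eq` (`n = 1`: `Λ₁(f₁) = Λ₀(f₀)` forces `|c₀| = |c₁|` — the
  `s = 1` case of E-an-66/67).

HONEST FRAMING: nothing here decides the parity of any Manin constant; C2 is not proved; Manin's conjecture is not
proved; BSD is not proved by this.  No definitions.
-/

set_option autoImplicit false
-- the summit-side namespace `Summit.BirchSwinnertonDyer.BirchSwinnertonDyer.…` is the tree's (summit = sub-problem)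
set_option linter.dupNamespace false

noncomputable section

open WeierstrassCurve Literature.NumberTheory.EllipticCurves Literature.NumberTheory.EllipticCurves.ModularForms
open Summit.BirchSwinnertonDyer.Rank1Residual.ManinAdditive.ShimuraLedger

namespace Summit.BirchSwinnertonDyer.BirchSwinnertonDyer.Theorems.ManinLocalTwoThree

variable {W₁ W₀ : WeierstrassCurve ℚ} [W₁.IsElliptic] [W₁.IsGloballyMinimal] [W₀.IsElliptic]
  [W₀.IsGloballyMinimal] {N : ℕ} [NeZero N]

/-- **Homothetic Shimura cover ⟹ `c₀ = ± n c₁`.**  Let `D₁` be an OPTIMAL `X₁(N)`-datum of a globally minimal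
`W₁` (`Λ_{E₁} = c₁ Λ₁(f₁)`), `D₀` an OPTIMAL `X₀(N)`-datum of a globally minimal `W₀` (`Λ_{E₀} = c₀ Λ₀(f₀)`), and
suppose `Λ₁(f₁) = n · Λ₀(f₀)` for an integer `n` (membership form).  Then `c₀ = n c₁` or `c₀ = -(n c₁)`.
Proof: `(n c₁/c₀)·Λ_{E₀} = n c₁ Λ₀(f₀) = c₁ Λ₁(f₁) ⊆ Λ_{E₁}` and `(c₀/(n c₁))·Λ_{E₁} = c₀ Λ₀(f₀) ⊆ Λ_{E₀}`; both
scalings are integers by `integral_neronScaling_of_isGloballyMinimal_holds`, and their product is `1`.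
(`n ≠ 0` is forced: `Λ_{E₁} ≠ 0`.)  No isogeny hypothesis is needed (the Néron-scaling theorem constructs the
isogeny `z ↦ q z`). -/
theorem maninConstant₀_eq_mul_or_eq_neg_mul_of_periodLatticeGamma1_eq_mul
    (D₁ : Gamma1ParametrizationData W₁ N) (D₀ : ModularParametrizationData W₀ N) (h₁ : D₁.IsOptimal)
    (h₀ : ∀ z ∈ D₀.L.lattice, ∃ w ∈ periodLattice D₀.f, z = D₀.c * w) (n : ℤ)
    (hidx : ∀ z : ℂ, z ∈ periodLatticeGamma1 D₁.f ↔ ∃ w ∈ periodLattice D₀.f, z = (n : ℂ) * w) :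
    D₀.maninConstant = n * D₁.maninConstant ∨ D₀.maninConstant = -(n * D₁.maninConstant) := by
  have hc₁ : (D₁.c : ℚ) ≠ 0 := by exact_mod_cast D₁.maninConstant_ne_zero
  have hc₁C : (D₁.c : ℂ) ≠ 0 := by exact_mod_cast D₁.maninConstant_ne_zero
  have hc₀ : (D₀.c : ℚ) ≠ 0 := by exact_mod_cast D₀.maninConstant_ne_zero_holds
  have hc₀C : (D₀.c : ℂ) ≠ 0 := by exact_mod_cast D₀.maninConstant_ne_zero_holds
  -- `n ≠ 0`: otherwise `Λ₁(f₁) = 0`, hence `Λ_{E₁} = 0`, but `ω₁ ∈ Λ_{E₁}` is non-zero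
  have hn : n ≠ 0 := by
    rintro rfl
    obtain ⟨w₁, hw₁, hω⟩ := h₁ D₁.L.ω₁ D₁.L.ω₁_mem_lattice
    obtain ⟨w, -, hw⟩ := (hidx w₁).mp hw₁
    rw [hw, Int.cast_zero, zero_mul, mul_zero] at hω
    exact (LinearIndependent.ne_zero 0 D₁.L.indep) (by simpa using hω)
  have hnQ : (n : ℚ) ≠ 0 := by exact_mod_cast hn
  have hnC : (n : ℂ) ≠ 0 := by exact_mod_cast hn
  -- `(n c₁/c₀) Λ_{E₀} ⊆ Λ_{E₁}`
  obtain ⟨k, hk⟩ := integral_neronScaling_of_isGloballyMinimal_holds W₀ W₁ D₀.L D₁.L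
    D₀.isNeronLattice D₁.isNeronLattice (((n * D₁.c : ℤ) : ℚ) / D₀.c) (fun z hz ↦ by
      obtain ⟨w, hw, rfl⟩ := h₀ z hz
      have hnw : (n : ℂ) * w ∈ periodLatticeGamma1 D₁.f := (hidx _).mpr ⟨w, hw, rfl⟩
      have e : (((((n * D₁.c : ℤ) : ℚ) / D₀.c : ℚ)) : ℂ) * ((D₀.c : ℂ) * w) =
          (D₁.c : ℂ) * ((n : ℂ) * w) := by
        push_cast
        field_simp
      rw [e]
      exact D₁.smul_periodLatticeGamma1_le _ hnw)
  -- `(c₀/(n c₁)) Λ_{E₁} ⊆ Λ_{E₀}`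
  obtain ⟨k', hk'⟩ := integral_neronScaling_of_isGloballyMinimal_holds W₁ W₀ D₁.L D₀.L
    D₁.isNeronLattice D₀.isNeronLattice ((D₀.c : ℚ) / ((n * D₁.c : ℤ) : ℚ)) (fun z hz ↦ by
      obtain ⟨w₁, hw₁, rfl⟩ := h₁ z hz
      obtain ⟨w, hw, rfl⟩ := (hidx w₁).mp hw₁
      have e : ((((D₀.c : ℚ) / ((n * D₁.c : ℤ) : ℚ) : ℚ)) : ℂ) * ((D₁.c : ℂ) * ((n : ℂ) * w)) =
          (D₀.c : ℂ) * w := by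
        push_cast
        field_simp
      rw [e]
      exact D₀.smul_periodLattice_le w hw)
  -- `k k' = 1`, so `k' = ±1`
  have hkk' : k * k' = 1 := by
    have h : ((k * k' : ℤ) : ℚ) = 1 := by
      push_cast
      rw [hk, hk']
      push_cast
      field_simp
    exact_mod_cast h
  rcases Int.eq_one_or_neg_one_of_mul_eq_one' hkk' with ⟨-, hk1⟩ | ⟨-, hk1⟩
  · left
    have e : (D₀.c : ℚ) = n * D₁.c := by
      have h := hk'
      rw [hk1, Int.cast_one, eq_div_iff (by push_cast; exact mul_ne_zero hnQ hc₁), one_mul] at h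
      rw [← h]
      push_cast
      ring
    change D₀.c = n * D₁.c
    exact_mod_cast e
  · right
    have e : (D₀.c : ℚ) = -(n * D₁.c) := by
      have h := hk'
      rw [hk1, Int.cast_neg, Int.cast_one, eq_div_iff (by push_cast; exact mul_ne_zero hnQ hc₁)] at h
      have h' : (D₀.c : ℚ) = -((n * D₁.c : ℤ) : ℚ) := by linear_combination -h
      rw [h']
      push_cast
      ring
    change D₀.c = -(n * D₁.c)
    exact_mod_cast e

/-- In absolute values: `Λ₁(f₁) = n · Λ₀(f₀)` (optimal data on globally minimal models) forces `|c₀| = |n| · |c₁|`. -/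
theorem natAbs_maninConstant₀_eq_mul_of_periodLatticeGamma1_eq_mul
    (D₁ : Gamma1ParametrizationData W₁ N) (D₀ : ModularParametrizationData W₀ N) (h₁ : D₁.IsOptimal)
    (h₀ : ∀ z ∈ D₀.L.lattice, ∃ w ∈ periodLattice D₀.f, z = D₀.c * w) (n : ℤ)
    (hidx : ∀ z : ℂ, z ∈ periodLatticeGamma1 D₁.f ↔ ∃ w ∈ periodLattice D₀.f, z = (n : ℂ) * w) :
    D₀.maninConstant.natAbs = n.natAbs * D₁.maninConstant.natAbs := by
  rcases maninConstant₀_eq_mul_or_eq_neg_mul_of_periodLatticeGamma1_eq_mul D₁ D₀ h₁ h₀ n hidx with h | h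
  · rw [h, Int.natAbs_mul]
  · rw [h, Int.natAbs_neg, Int.natAbs_mul]

/-- **E-an-68 `GammaOneIndexFourForcesEvenManin` HOLDS** (cell bsd-f2-manin, an g16 MEMO-an §58; refuter-1 §R55 «TRUE on
paper from in-tree ingredients alone»): if `Λ₁(f₁) = 2 · Λ₀(f₀)` (index `4`, the extreme case allowed by Ling–Oesterlé
at `4 ∣ N`) then `c₀ = ± 2 c₁`, in particular `2 ∣ c₀`.  The leaf's argument goes through the rigidity of Néron
lattices; the proof here goes through the integral Néron scaling in both directions (`n = 2` in
`maninConstant₀_eq_mul_or_eq_neg_mul_of_periodLatticeGamma1_eq_mul`). -/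
theorem gammaOneIndexFourForcesEvenManin_holds : GammaOneIndexFourForcesEvenManin := by
  intro W₁ W₀ _ _ _ _ N _ D₁ D₀ h₁ h₀ hidx
  have hidx' : ∀ z : ℂ, z ∈ periodLatticeGamma1 D₁.f ↔ ∃ w ∈ periodLattice D₀.f, z = ((2 : ℤ) : ℂ) * w := by
    intro z
    rw [hidx z, Int.cast_ofNat]
  rcases maninConstant₀_eq_mul_or_eq_neg_mul_of_periodLatticeGamma1_eq_mul D₁ D₀ h₁ h₀ 2 hidx' with h | h
  · exact ⟨D₁.maninConstant, h⟩
  · exact ⟨-D₁.maninConstant, by rw [h]; ring⟩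

/-- Sharper form of E-an-68: index `4` forces `|c₀| = 2 |c₁|` exactly. -/
theorem natAbs_maninConstant₀_eq_two_mul_of_index_four
    (D₁ : Gamma1ParametrizationData W₁ N) (D₀ : ModularParametrizationData W₀ N) (h₁ : D₁.IsOptimal)
    (h₀ : ∀ z ∈ D₀.L.lattice, ∃ w ∈ periodLattice D₀.f, z = D₀.c * w)
    (hidx : ∀ z : ℂ, z ∈ periodLatticeGamma1 D₁.f ↔ ∃ w ∈ periodLattice D₀.f, z = 2 * w) :
    D₀.maninConstant.natAbs = 2 * D₁.maninConstant.natAbs := by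
  have hidx' : ∀ z : ℂ, z ∈ periodLatticeGamma1 D₁.f ↔ ∃ w ∈ periodLattice D₀.f, z = ((2 : ℤ) : ℂ) * w := by
    intro z
    rw [hidx z, Int.cast_ofNat]
  simpa using natAbs_maninConstant₀_eq_mul_of_periodLatticeGamma1_eq_mul D₁ D₀ h₁ h₀ 2 hidx'

/-- **The leaf's edge `index_ne_four_of_maninOdd` with its hypothesis discharged**: C2 for the optimal `X₀(N)`-datum
`D₀` (`2 ∤ c₀`) forbids `Λ₁(f₁) = 2Λ₀(f₀)` for every optimal `X₁(N)`-datum `D₁`. -/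
theorem index_ne_four_of_not_two_dvd_maninConstant
    (D₁ : Gamma1ParametrizationData W₁ N) (D₀ : ModularParametrizationData W₀ N) (h₁ : D₁.IsOptimal)
    (h₀ : ∀ z ∈ D₀.L.lattice, ∃ w ∈ periodLattice D₀.f, z = D₀.c * w) (hodd : ¬ (2 : ℤ) ∣ D₀.maninConstant) :
    ¬ (∀ z : ℂ, z ∈ periodLatticeGamma1 D₁.f ↔ ∃ w ∈ periodLattice D₀.f, z = 2 * w) :=
  index_ne_four_of_maninOdd gammaOneIndexFourForcesEvenManin_holds W₁ W₀ D₁ D₀ h₁ h₀ hodd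

/-- **Index `1` forces `|c₀| = |c₁|`** (the `s = 1` case of the an planner's E-an-66/67): if `Λ₁(f₁) = Λ₀(f₀)` then the
two optimal constants agree up to sign (`n = 1`). -/
theorem natAbs_maninConstant₀_eq_of_periodLatticeGamma1_eq
    (D₁ : Gamma1ParametrizationData W₁ N) (D₀ : ModularParametrizationData W₀ N) (h₁ : D₁.IsOptimal)
    (h₀ : ∀ z ∈ D₀.L.lattice, ∃ w ∈ periodLattice D₀.f, z = D₀.c * w)
    (hidx : ∀ z : ℂ, z ∈ periodLatticeGamma1 D₁.f ↔ z ∈ periodLattice D₀.f) :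
    D₀.maninConstant.natAbs = D₁.maninConstant.natAbs := by
  have hidx' : ∀ z : ℂ, z ∈ periodLatticeGamma1 D₁.f ↔ ∃ w ∈ periodLattice D₀.f, z = ((1 : ℤ) : ℂ) * w := by
    intro z
    rw [hidx z]
    constructor
    · intro hz
      exact ⟨z, hz, by simp⟩
    · rintro ⟨w, hw, rfl⟩
      simpa using hw
  simpa using natAbs_maninConstant₀_eq_mul_of_periodLatticeGamma1_eq_mul D₁ D₀ h₁ h₀ 1 hidx'

/-- Index `1`, same-newform form (`D₁.f = D₀.f`, e.g. for isogenous curves, and `Λ₁(f) = Λ₀(f)` as additive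
subgroups — the conclusion of the tree's `Gamma1LatticeEqOfTwoTracelessPrimes` at a level with two traceless primes):
`|c₀| = |c₁|`. -/
theorem natAbs_maninConstant₀_eq_of_periodLatticeGamma1_eq_periodLattice
    (D₁ : Gamma1ParametrizationData W₁ N) (D₀ : ModularParametrizationData W₀ N) (h₁ : D₁.IsOptimal)
    (h₀ : ∀ z ∈ D₀.L.lattice, ∃ w ∈ periodLattice D₀.f, z = D₀.c * w) (hf : D₁.f = D₀.f)
    (hΛ : periodLatticeGamma1 D₀.f = periodLattice D₀.f) :
    D₀.maninConstant.natAbs = D₁.maninConstant.natAbs :=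
  natAbs_maninConstant₀_eq_of_periodLatticeGamma1_eq D₁ D₀ h₁ h₀ fun z ↦ by rw [hf, hΛ]

end Summit.BirchSwinnertonDyer.BirchSwinnertonDyer.Theorems.ManinLocalTwoThree

end
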